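import Summits.HodgeConjecture.HodgeConjecture.Theses.TropicalWeilObstruction
import Summits.HodgeConjecture.HodgeConjecture.Theorems.TropicalWeilObstructionTropicalWeilVanishingDegreeLadderStokes
import HarnessLib

/-!
# Route `TropicalWeilObstruction` (Kontsevich's tropical test — NEGATION SINK, exploration, no summit claim):
# the degree ladder of K1 — III. combinatorics of faces (`∂∂ = 0`, alternation of the boundary pairing)

Negation-sink bookkeeping of the cell `pub-hodge-tropical` (seat tropical-1 gen 7); part III of the DEGREE LADDER (parts I–II:
`…DegreeLadderStokes` p343636, `…DegreeLadder` p344212). The integrality `24 ∣ intCoord Z` of the class of an effective tropical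
`4`-cycle (`[Z] ∈ ⋀⁴(Qℤᵍ) ⊗ ⋀⁴ℤᵍ`, [cite: MikhalkinZharkov2014Eigenwave, Prop. 4.3]) is proved in parts III–VI by an elementary
descent through the faces of the floored cells (numerics: HOME `tools/descent/`). This file holds the finite combinatorics, all
`decide`-checked on explicit tables:

* `sum_sum_sign_faceFace` — `Σ_{i<5} Σ_{l<4} (−1)^{i+l} F(x∘δ_i∘δ_l) = 0` for every function `F` of `3`-tuples (`∂∂ = 0` on a
  `4`-simplex), and `sum_sum_sign_faceFace₃` — the same one level down (`4`-tuples, functions of `2`-tuples);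
* `boundaryPairing_perm` — for `F` ALTERNATING on `3`-tuples the boundary pairing `y ↦ Σ_l (−1)^l F(y∘δ_l)` is alternating in
  the four points (`swap_face`: a transposition carries face `l` to face `swap l` with the recorded sign; `swap_induction_on`);
  `boundaryPairing_perm₃` — the same for functions of `2`-tuples and three points.

HONEST STATUS. Elementary algebra/combinatorics on the certificate format; decides nothing about K1 (`TropicalWeilVanishing`,
stmt-HodgeConjecture-18478, an OPEN problem) or about the Hodge conjecture. No definition (display-only notation), no named fact,
no sorry.
References: [MikhalkinZharkov2014Eigenwave] G. Mikhalkin, I. Zharkov, Tropical eigenwave and intermediate Jacobians,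
LN UMI 15 (2014), Def. 4.2, Prop. 4.3, Thm. 5.4; [Zharkov2020TropicalWeil] I. Zharkov, arXiv:2002.02347, p. 2, §2.
-/

set_option linter.dupNamespace false

noncomputable section

open scoped BigOperators
open Matrix
open Literature.AlgebraicGeometry.Tropical
open Summit.HodgeConjecture.HodgeConjecture.Theorems.TropicalHodgeBound

namespace Summit.HodgeConjecture.HodgeConjecture.Theorems.TropicalWeilVanishing.Ladder

/-! ## §0 Display-only notation (nothing is defined) -/

/-- The pairing table of `∂∂ = 0`: the partner of the slot pair `(i, l)` of a `5`-tuple. Nothing is defined. -/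
local notation3 (prettyPrint := false) "ffT" =>
  (![![((1 : Fin 5), (0 : Fin 4)), (2, 0), (3, 0), (4, 0)],
     ![(0, 0), (2, 1), (3, 1), (4, 1)],
     ![(0, 1), (1, 1), (3, 2), (4, 2)],
     ![(0, 2), (1, 2), (2, 2), (4, 3)],
     ![(0, 3), (1, 3), (2, 3), (3, 3)]] : Fin 5 → Fin 4 → Fin 5 × Fin 4)

/-- The pairing table of `∂∂ = 0` one level down: the partner of the slot pair `(l, j)` of a `4`-tuple. Nothing is defined. -/
local notation3 (prettyPrint := false) "ffT₃" =>
  (![![((1 : Fin 4), (0 : Fin 3)), (2, 0), (3, 0)],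
     ![(0, 0), (2, 1), (3, 1)],
     ![(0, 1), (1, 1), (3, 2)],
     ![(0, 2), (1, 2), (2, 2)]] : Fin 4 → Fin 3 → Fin 4 × Fin 3)

/-! ## §1 Combinatorics of faces -/

section Faces

variable {X : Type*} {A : Type*} [AddCommGroup A]

/-- The partner slot pair gives the same `2`-face. [folklore] -/
theorem ffT_word : ∀ p : Fin 5 × Fin 4, ∀ j : Fin 3,
    (ffT p.1 p.2).1.succAbove ((ffT p.1 p.2).2.succAbove j) = p.1.succAbove (p.2.succAbove j) := by decide

/-- The partner slot pair has the opposite sign. [folklore] -/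
theorem ffT_sign : ∀ p : Fin 5 × Fin 4,
    ((-1 : ℤ) ^ (((ffT p.1 p.2).1 : ℕ) + ((ffT p.1 p.2).2 : ℕ))) = -((-1 : ℤ) ^ ((p.1 : ℕ) + (p.2 : ℕ))) := by decide

/-- The pairing has no fixed point. [folklore] -/
theorem ffT_ne : ∀ p : Fin 5 × Fin 4, ffT p.1 p.2 ≠ p := by decide

/-- The pairing is an involution. [folklore] -/
theorem ffT_ffT : ∀ p : Fin 5 × Fin 4, ffT (ffT p.1 p.2).1 (ffT p.1 p.2).2 = p := by decide

/-- **`∂∂ = 0`**: `Σ_i Σ_l (-1)^(i+l) F(x ∘ δ_i ∘ δ_l) = 0` for every function `F` of `3`-tuples and every `5`-tuple `x`.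
[folklore] -/
theorem sum_sum_sign_faceFace (F : (Fin 3 → X) → A) (x : Fin 5 → X) :
    ∑ i : Fin 5, ∑ l : Fin 4, ((-1 : ℤ) ^ ((i : ℕ) + (l : ℕ))) • F (fun j => x (i.succAbove (l.succAbove j))) = 0 := by
  rw [← Fintype.sum_prod_type']
  refine Finset.sum_involution (fun p _ => ffT p.1 p.2) ?_ ?_ ?_ ?_
  · intro p _
    have hw : (fun j => x ((ffT p.1 p.2).1.succAbove ((ffT p.1 p.2).2.succAbove j))) =
        fun j => x (p.1.succAbove (p.2.succAbove j)) := by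
      funext j; rw [ffT_word p j]
    rw [hw, ffT_sign p, neg_smul, add_neg_cancel]
  · intro p _ _; exact ffT_ne p
  · intro p _; exact Finset.mem_univ _
  · intro p _; exact ffT_ffT p

/-- A transposition of the four points carries the face `l` to the face `swap l`, reordered with the recorded sign.
[folklore] -/
theorem swap_face : ∀ a b : Fin 4, a ≠ b → ∀ l : Fin 4, ∃ κ : Equiv.Perm (Fin 3),
    (∀ j, Equiv.swap a b (l.succAbove j) = (Equiv.swap a b l).succAbove (κ j)) ∧
      ((Equiv.Perm.sign κ : ℤˣ) : ℤ) * (-1) ^ (l : ℕ) = -((-1 : ℤ) ^ ((Equiv.swap a b l : Fin 4) : ℕ)) := by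
  decide

/-- The boundary pairing `y ↦ Σ_l (-1)^l F(y ∘ δ_l)` of an alternating `F` changes sign under a transposition. [folklore] -/
theorem boundaryPairing_swap (F : (Fin 3 → X) → A)
    (hF : ∀ (z : Fin 3 → X) (κ : Equiv.Perm (Fin 3)), F (fun j => z (κ j)) = ((Equiv.Perm.sign κ : ℤˣ) : ℤ) • F z)
    (y : Fin 4 → X) (a b : Fin 4) (hab : a ≠ b) :
    ∑ l : Fin 4, ((-1 : ℤ) ^ (l : ℕ)) • F (fun j => y (Equiv.swap a b (l.succAbove j))) =
      -∑ l : Fin 4, ((-1 : ℤ) ^ (l : ℕ)) • F (fun j => y (l.succAbove j)) := by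
  have key : ∀ l : Fin 4, ((-1 : ℤ) ^ (l : ℕ)) • F (fun j => y (Equiv.swap a b (l.succAbove j))) =
      -(((-1 : ℤ) ^ ((Equiv.swap a b l : Fin 4) : ℕ)) • F (fun j => y ((Equiv.swap a b l).succAbove j))) := by
    intro l
    obtain ⟨κ, hκ, hs⟩ := swap_face a b hab l
    have e : (fun j => y (Equiv.swap a b (l.succAbove j))) =
        fun j => y ((Equiv.swap a b l).succAbove (κ j)) := by
      funext j; simp only [hκ]
    have hF' := hF (fun j' => y ((Equiv.swap a b l).succAbove j')) κ
    rw [e, hF', smul_smul, mul_comm, hs, neg_smul]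
  simp_rw [key]
  rw [Finset.sum_neg_distrib]
  congr 1
  exact Equiv.sum_comp (Equiv.swap a b) (fun l => ((-1 : ℤ) ^ (l : ℕ)) • F (fun j => y (l.succAbove j)))

/-- **The boundary pairing of an alternating function is alternating**: for every reordering `π` of the four points,
`Σ_l (-1)^l F((y∘π) ∘ δ_l) = sign π · Σ_l (-1)^l F(y ∘ δ_l)`. [folklore] -/
theorem boundaryPairing_perm (F : (Fin 3 → X) → A)
    (hF : ∀ (z : Fin 3 → X) (κ : Equiv.Perm (Fin 3)), F (fun j => z (κ j)) = ((Equiv.Perm.sign κ : ℤˣ) : ℤ) • F z)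
    (π : Equiv.Perm (Fin 4)) (y : Fin 4 → X) :
    ∑ l : Fin 4, ((-1 : ℤ) ^ (l : ℕ)) • F (fun j => y (π (l.succAbove j))) =
      ((Equiv.Perm.sign π : ℤˣ) : ℤ) • ∑ l : Fin 4, ((-1 : ℤ) ^ (l : ℕ)) • F (fun j => y (l.succAbove j)) := by
  induction π using Equiv.Perm.swap_induction_on generalizing y with
  | one => simp
  | swap_mul f a b hab ih =>
    have e : ∀ l : Fin 4, (fun j => y ((Equiv.swap a b * f) (l.succAbove j))) =
        fun j => (fun m => y (Equiv.swap a b m)) (f (l.succAbove j)) := fun l => rfl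
    simp_rw [e]
    rw [ih (fun m => y (Equiv.swap a b m)), boundaryPairing_swap F hF y a b hab, Equiv.Perm.sign_mul,
      Equiv.Perm.sign_swap hab, Units.val_mul, Units.val_neg, Units.val_one, smul_neg, neg_mul, one_mul, neg_smul]


/-! ### One level down: faces of `4`-tuples, functions of `2`-tuples -/

/-- The partner slot pair gives the same `1`-face. [folklore] -/
theorem ffT₃_word : ∀ p : Fin 4 × Fin 3, ∀ m : Fin 2,
    (ffT₃ p.1 p.2).1.succAbove ((ffT₃ p.1 p.2).2.succAbove m) = p.1.succAbove (p.2.succAbove m) := by decide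

/-- The partner slot pair has the opposite sign. [folklore] -/
theorem ffT₃_sign : ∀ p : Fin 4 × Fin 3,
    ((-1 : ℤ) ^ (((ffT₃ p.1 p.2).1 : ℕ) + ((ffT₃ p.1 p.2).2 : ℕ))) = -((-1 : ℤ) ^ ((p.1 : ℕ) + (p.2 : ℕ))) := by decide

/-- The pairing has no fixed point. [folklore] -/
theorem ffT₃_ne : ∀ p : Fin 4 × Fin 3, ffT₃ p.1 p.2 ≠ p := by decide

/-- The pairing is an involution. [folklore] -/
theorem ffT₃_ffT₃ : ∀ p : Fin 4 × Fin 3, ffT₃ (ffT₃ p.1 p.2).1 (ffT₃ p.1 p.2).2 = p := by decide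

/-- **`∂∂ = 0` one level down**: `Σ_l Σ_j (-1)^(l+j) F(y ∘ δ_l ∘ δ_j) = 0` for every function `F` of `2`-tuples and
every `4`-tuple `y`. [folklore] -/
theorem sum_sum_sign_faceFace₃ (F : (Fin 2 → X) → A) (y : Fin 4 → X) :
    ∑ l : Fin 4, ∑ j : Fin 3, ((-1 : ℤ) ^ ((l : ℕ) + (j : ℕ))) • F (fun m => y (l.succAbove (j.succAbove m))) = 0 := by
  rw [← Fintype.sum_prod_type']
  refine Finset.sum_involution (fun p _ => ffT₃ p.1 p.2) ?_ ?_ ?_ ?_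
  · intro p _
    have hw : (fun m => y ((ffT₃ p.1 p.2).1.succAbove ((ffT₃ p.1 p.2).2.succAbove m))) =
        fun m => y (p.1.succAbove (p.2.succAbove m)) := by
      funext m; rw [ffT₃_word p m]
    rw [hw, ffT₃_sign p, neg_smul, add_neg_cancel]
  · intro p _ _; exact ffT₃_ne p
  · intro p _; exact Finset.mem_univ _
  · intro p _; exact ffT₃_ffT₃ p

/-- A transposition of three points carries the face `j` to the face `swap j`, reordered with the recorded sign.
[folklore] -/
theorem swap_face₃ : ∀ a b : Fin 3, a ≠ b → ∀ j : Fin 3, ∃ κ : Equiv.Perm (Fin 2),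
    (∀ m, Equiv.swap a b (j.succAbove m) = (Equiv.swap a b j).succAbove (κ m)) ∧
      ((Equiv.Perm.sign κ : ℤˣ) : ℤ) * (-1) ^ (j : ℕ) = -((-1 : ℤ) ^ ((Equiv.swap a b j : Fin 3) : ℕ)) := by
  decide

/-- The boundary pairing `z ↦ Σ_j (-1)^j F(z ∘ δ_j)` of an alternating function `F` of `2`-tuples changes sign under a
transposition of the three points. [folklore] -/
theorem boundaryPairing_swap₃ (F : (Fin 2 → X) → A)
    (hF : ∀ (w : Fin 2 → X) (κ : Equiv.Perm (Fin 2)), F (fun m => w (κ m)) = ((Equiv.Perm.sign κ : ℤˣ) : ℤ) • F w)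
    (z : Fin 3 → X) (a b : Fin 3) (hab : a ≠ b) :
    ∑ j : Fin 3, ((-1 : ℤ) ^ (j : ℕ)) • F (fun m => z (Equiv.swap a b (j.succAbove m))) =
      -∑ j : Fin 3, ((-1 : ℤ) ^ (j : ℕ)) • F (fun m => z (j.succAbove m)) := by
  have key : ∀ j : Fin 3, ((-1 : ℤ) ^ (j : ℕ)) • F (fun m => z (Equiv.swap a b (j.succAbove m))) =
      -(((-1 : ℤ) ^ ((Equiv.swap a b j : Fin 3) : ℕ)) • F (fun m => z ((Equiv.swap a b j).succAbove m))) := by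
    intro j
    obtain ⟨κ, hκ, hs⟩ := swap_face₃ a b hab j
    have e : (fun m => z (Equiv.swap a b (j.succAbove m))) =
        fun m => z ((Equiv.swap a b j).succAbove (κ m)) := by
      funext m; simp only [hκ]
    have hF' := hF (fun m' => z ((Equiv.swap a b j).succAbove m')) κ
    rw [e, hF', smul_smul, mul_comm, hs, neg_smul]
  simp_rw [key]
  rw [Finset.sum_neg_distrib]
  congr 1
  exact Equiv.sum_comp (Equiv.swap a b) (fun j => ((-1 : ℤ) ^ (j : ℕ)) • F (fun m => z (j.succAbove m)))

/-- **The boundary pairing of an alternating function of `2`-tuples is alternating in the three points.** [folklore] -/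
theorem boundaryPairing_perm₃ (F : (Fin 2 → X) → A)
    (hF : ∀ (w : Fin 2 → X) (κ : Equiv.Perm (Fin 2)), F (fun m => w (κ m)) = ((Equiv.Perm.sign κ : ℤˣ) : ℤ) • F w)
    (π : Equiv.Perm (Fin 3)) (z : Fin 3 → X) :
    ∑ j : Fin 3, ((-1 : ℤ) ^ (j : ℕ)) • F (fun m => z (π (j.succAbove m))) =
      ((Equiv.Perm.sign π : ℤˣ) : ℤ) • ∑ j : Fin 3, ((-1 : ℤ) ^ (j : ℕ)) • F (fun m => z (j.succAbove m)) := by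
  induction π using Equiv.Perm.swap_induction_on generalizing z with
  | one => simp
  | swap_mul f a b hab ih =>
    have e : ∀ j : Fin 3, (fun m => z ((Equiv.swap a b * f) (j.succAbove m))) =
        fun m => (fun q => z (Equiv.swap a b q)) (f (j.succAbove m)) := fun j => rfl
    simp_rw [e]
    rw [ih (fun q => z (Equiv.swap a b q)), boundaryPairing_swap₃ F hF z a b hab, Equiv.Perm.sign_mul,
      Equiv.Perm.sign_swap hab, Units.val_mul, Units.val_neg, Units.val_one, smul_neg, neg_mul, one_mul, neg_smul]

end Faces


end Summit.HodgeConjecture.HodgeConjecture.Theorems.TropicalWeilVanishing.Ladder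

end
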